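import Literature.NumberTheory.EllipticCurves.RealLatticePeriodProofs
import Literature.NumberTheory.EllipticCurves.RealLatticePeriodHalfPeriodsProofs
import HarnessLib

/-!
# The bounded real component and the real-period formula for a real lattice

Discharges (D-0014 sibling `…Proofs` file) of the remaining two named facts of
`Literature/NumberTheory/EllipticCurves/RealLatticePeriod.lean` for a real lattice `Λ` (least
positive real period `Ω₀`, `e₁ = ℘(Ω₀/2)`, real invariants `g₂, g₃`, `f(x) = 4x³ − g₂x − g₃`,
`disc f = g₂³ − 27g₃²`):

* `PeriodPair.IsReal.integral_inv_sqrt_cubic_of_discr_pos_holds` (Lawden (6.12.18), §6.16):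
  if `disc f > 0` then `∫_{{f > 0, x < e₁}} dx/√f(x) = Ω₀/2`;
* `PeriodPair.IsReal.realPeriod_formula_holds` (Lawden (6.12.4), (6.12.18), (6.17.4), §6.16;
  Silverman AEC C.16): if `disc f ≠ 0` then `2∫_{f > 0} dx/√f(x) = n · Ω₀`, `n = 2` if
  `disc f > 0`, `n = 1` otherwise.

Lawden derives these from the classification of real lattices into rectangular (`disc > 0`,
three real roots `e₁ > e₂ > e₃`, §6.11–6.12, §6.16) and rhombic ones (`disc < 0`, §6.15–6.17)
and the mapping properties of `℘` on the period rectangle.  Our proof extracts the minimum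
needed, on top of the monotonicity theorem of `RealLatticePeriodProofs.lean`
(`℘` decreases from `+∞` to `e₁` on `(0, Ω₀/2]`, whence `f > 0` on `(e₁, ∞)`,
`IsReal.cubic_pos_of_lt`) and of `two_mul_mem_lattice_of_derivWeierstrassP_eq_zero`
(`RealLatticePeriodHalfPeriodsProofs.lean`):

1. The rotated lattice `iΛ` is again real (`IsReal.mulLeft_I`), with `℘_Λ(iz) = −℘_{iΛ}(z)`,
   `g₂(iΛ) = g₂`, `g₃(iΛ) = −g₃`; the monotonicity theorem for `iΛ` gives `f < 0` on
   `(−∞, ℘(w))`, `w = iΩ₀'/2`, `Ω₀'` the least positive real period of `iΛ`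
   (`IsReal.cubic_neg_of_lt`; Lawden (6.10.11)–(6.10.14) and §6.11, p. 170 "on `OY`").  Here
   `2w ∈ Λ`, `w ∉ Λ`, `conj w = −w`.
2. Real periods are the integer multiples of `Ω₀` (`IsReal.exists_eq_int_mul`).
3. *Rhombic case* `w + Ω₀/2 ∈ Λ`: then `℘(w) = e₁` is the only real root of `f`, which contradicts
   `disc f = (g₂ − 3e₁²)(12e₁² − g₂)² > 0` (the quadratic cofactor of `x − e₁` has the two real
   roots `(−e₁ ± √(g₂ − 3e₁²))/2`).  So for `disc f > 0` we are in the
4. *Rectangular case* `w + Ω₀/2 ∉ Λ`: by 2. the line `w + ℝ` misses `Λ`; on it `℘`, `℘'` are real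
   (`conj (w + t) = −w + t ≡ w + t (mod Λ)`), `℘'(w + t) ≠ 0` for `0 < t < Ω₀/2` (a zero would give
   the real period `2t < Ω₀`), so `t ↦ ℘(w + t)` is strictly monotone on `[0, Ω₀/2]` and maps
   `(0, Ω₀/2)` onto an interval `(m, M)` between the roots `℘(w)`, `℘(w + Ω₀/2)` of `f`, with
   `f = ℘'² > 0` there and `∫_m^M dx/√f = Ω₀/2` by the change of variables `x = ℘(w + t)`
   (`IsReal.exists_Ioo_integral_eq_of_line`; Lawden integrates `t = ℘(u + ω₂)` instead,
   (6.12.12)–(6.12.13), p. 172).  Finally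
   `M ≤ e₁` (`f(M) = 0`, `f > 0` beyond `e₁`), `M ≠ e₁` (else `e₁` is a root without sign change,
   `12e₁² = g₂`, `disc f = 0`), so `m < M < e₁` are the three roots and `{f > 0, x < e₁} = (m, M)`.
5. The real-period formula follows by splitting `{f > 0} = {f > 0, x < e₁} ∪ (e₁, ∞)`; for
   `disc f < 0` the first piece is empty since the cofactor `(2x + e₁)² + 3e₁² − g₂` is positive.

## References

* D. F. Lawden, *Elliptic Functions and Applications*, Applied Math. Sciences 80, Springer 1989,
  §6.10 eqs. (6.10.11)–(6.10.14), §§6.11–6.12, eqs. (6.12.4), (6.12.18), §§6.15–6.17,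
  eq. (6.17.4).
* J. H. Silverman, *The Arithmetic of Elliptic Curves*, 2nd ed., GTM 106, Springer 2009, C.16;
  *Advanced Topics in the Arithmetic of Elliptic Curves*, Cor. V.2.3.1.
-/

noncomputable section

open scoped ComplexConjugate Topology
open Filter Set MeasureTheory Complex

namespace PeriodPair

variable {L : PeriodPair}

/-! ### The rotated lattice `iΛ` -/

/-- `iΛ` is a real lattice if `Λ` is (`conj (i z) = -(i · conj z)`). [folklore] -/
lemma IsReal.mulLeft_I (h : L.IsReal) : (L.mulLeft I I_ne_zero).IsReal := by
  intro z hz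
  rw [mem_mulLeft_lattice] at hz ⊢
  have h1 : I⁻¹ * conj z = -conj (I⁻¹ * z) := by
    rw [map_mul, Complex.inv_I, map_neg, Complex.conj_I]; ring
  rw [h1]
  exact neg_mem (h _ hz)

/-- `℘_Λ(iz) = -℘_{iΛ}(z)` (Lawden (6.10.11), (6.10.14)). [folklore] -/
lemma weierstrassP_I_mul (L : PeriodPair) (z : ℂ) :
    ℘[L] (I * z) = -℘[L.mulLeft I I_ne_zero] z := by
  have := L.weierstrassP_mulLeft I I_ne_zero (I * z)
  rw [← mul_assoc, Complex.I_mul_I, neg_one_mul, weierstrassP_neg, Complex.I_sq, inv_neg,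
    inv_one, neg_one_mul] at this
  linear_combination this

/-- `℘'_Λ(iz) = i ℘'_{iΛ}(z)`. [folklore] -/
lemma derivWeierstrassP_I_mul (L : PeriodPair) (z : ℂ) :
    ℘'[L] (I * z) = I * ℘'[L.mulLeft I I_ne_zero] z := by
  have := L.derivWeierstrassP_mulLeft I I_ne_zero (I * z)
  rw [← mul_assoc, Complex.I_mul_I, neg_one_mul, derivWeierstrassP_neg, pow_succ, Complex.I_sq]
    at this
  have hI : ((-1 : ℂ) * I)⁻¹ = I := by
    rw [neg_one_mul, inv_neg, Complex.inv_I, neg_neg]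
  rw [hI] at this
  -- this : -℘'[iΛ] z = I * ℘'[Λ] (I z)
  have hII : I * I = -1 := Complex.I_mul_I
  linear_combination I * this + (℘'[L] (I * z)) * hII

/-- `g₂(iΛ) = g₂(Λ)` (Lawden (6.10.13)). [folklore] -/
lemma g₂_mulLeft_I (L : PeriodPair) : (L.mulLeft I I_ne_zero).g₂ = L.g₂ := by
  rw [g₂_mulLeft, Complex.I_pow_four, inv_one, one_mul]

/-- `g₃(iΛ) = -g₃(Λ)` (Lawden (6.10.13)). [folklore] -/
lemma g₃_mulLeft_I (L : PeriodPair) : (L.mulLeft I I_ne_zero).g₃ = -L.g₃ := by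
  rw [g₃_mulLeft, show (6 : ℕ) = 2 * 3 from rfl, pow_mul, Complex.I_sq]
  norm_num

/-! ### Real periods are the integer multiples of `Ω₀` -/

/-- For a real lattice, every real period is an integer multiple of the least positive one
(`Λ ∩ ℝ = ℤΩ₀`, Lawden §6.15). [folklore] -/
lemma IsReal.exists_eq_int_mul (h : L.IsReal) {t : ℝ} (ht : (t : ℂ) ∈ L.lattice) :
    ∃ k : ℤ, t = k * L.minRealPeriod := by
  have hΩ := h.minRealPeriod_pos
  refine ⟨⌊t / L.minRealPeriod⌋, ?_⟩
  set k := ⌊t / L.minRealPeriod⌋ with hk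
  have h1 : (k : ℝ) ≤ t / L.minRealPeriod := Int.floor_le _
  have h2 : t / L.minRealPeriod < k + 1 := Int.lt_floor_add_one _
  have hr0 : 0 ≤ t - k * L.minRealPeriod := by rw [le_div_iff₀ hΩ] at h1; linarith
  have hr1 : t - k * L.minRealPeriod < L.minRealPeriod := by rw [div_lt_iff₀ hΩ] at h2; linarith
  have hkmem : ((k : ℝ) : ℂ) * (L.minRealPeriod : ℂ) ∈ L.lattice := by
    have := zsmul_mem h.minRealPeriod_mem_lattice k
    rw [zsmul_eq_mul] at this
    exact_mod_cast this
  have hrmem : ((t - k * L.minRealPeriod : ℝ) : ℂ) ∈ L.lattice := by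
    push_cast
    exact sub_mem ht (by exact_mod_cast hkmem)
  rcases hr0.eq_or_lt with hr | hr
  · linarith
  · have := h.minRealPeriod_le ⟨hr, hrmem⟩
    linarith

/-! ### Sign of the cubic on the two unbounded pieces -/

/-- `e₁ = ℘(Ω₀/2)` is a root of `f = 4x³ − g₂x − g₃` (`℘'(Ω₀/2) = 0`). [folklore] -/
lemma IsReal.cubic_weierstrassPRe_half (h : L.IsReal) :
    4 * L.weierstrassPRe (L.minRealPeriod / 2) ^ 3 -
      L.g₂.re * L.weierstrassPRe (L.minRealPeriod / 2) - L.g₃.re = 0 := by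
  have hΩ := h.minRealPeriod_pos
  rw [← h.derivWeierstrassPRe_sq (h.ofReal_notMem_lattice (by positivity) (by linarith)),
    derivWeierstrassPRe, h.derivWeierstrassP_minRealPeriod_div_two, Complex.zero_re]
  ring

/-- `f > 0` on `(e₁, ∞)`: there `x = ℘(t)` with `t ∈ (0, Ω₀/2)` and `f(x) = ℘'(t)² > 0`
(Lawden §6.11). [folklore] -/
lemma IsReal.cubic_pos_of_lt (h : L.IsReal) {x : ℝ}
    (hx : L.weierstrassPRe (L.minRealPeriod / 2) < x) :
    0 < 4 * x ^ 3 - L.g₂.re * x - L.g₃.re := by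
  have hx' : x ∈ L.weierstrassPRe '' Ioo 0 (L.minRealPeriod / 2) := by
    rw [h.image_weierstrassPRe_Ioo]; exact hx
  obtain ⟨s, hs, rfl⟩ := hx'
  rw [← h.derivWeierstrassPRe_sq (h.ofReal_notMem_lattice hs.1
    (by linarith [hs.2, h.minRealPeriod_pos])), sq]
  have := h.derivWeierstrassPRe_neg hs.1 hs.2
  exact mul_pos_of_neg_of_neg this this

/-- `f < 0` on `(-∞, e')`, `e' = ℘_Λ(iΩ₀'/2) = -℘_{iΛ}(Ω₀'/2)` where `Ω₀'` is the least positive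
real period of the real lattice `iΛ`: the previous lemma for `iΛ`, whose cubic is `-f(-x)`
(Lawden (6.10.14) `℘(u | g₂, −g₃) = −℘(iu | g₂, g₃)` and §6.11, p. 170). [folklore] -/
lemma IsReal.cubic_neg_of_lt (h : L.IsReal) {x : ℝ}
    (hx : x < -(L.mulLeft I I_ne_zero).weierstrassPRe ((L.mulLeft I I_ne_zero).minRealPeriod / 2)) :
    4 * x ^ 3 - L.g₂.re * x - L.g₃.re < 0 := by
  have := h.mulLeft_I.cubic_pos_of_lt (x := -x) (by linarith)
  rw [g₂_mulLeft_I, g₃_mulLeft_I, Complex.neg_re] at this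
  linarith

/-! ### Elementary algebra of the cubic `4x³ − Ax − B` -/

/-- Factorisation through a root. [folklore] -/
lemma cubic_eq_mul_of_root {A B e : ℝ} (he : 4 * e ^ 3 - A * e - B = 0) (x : ℝ) :
    4 * x ^ 3 - A * x - B = (x - e) * (4 * x ^ 2 + 4 * e * x + (4 * e ^ 2 - A)) := by
  linear_combination he

/-- The discriminant in terms of a root: `A³ − 27B² = (A − 3e²)(12e² − A)²`. [folklore] -/
lemma cubic_discr_eq_of_root {A B e : ℝ} (he : 4 * e ^ 3 - A * e - B = 0) :
    A ^ 3 - 27 * B ^ 2 = (A - 3 * e ^ 2) * (12 * e ^ 2 - A) ^ 2 := by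
  obtain rfl : B = 4 * e ^ 3 - A * e := by linarith
  ring

/-- A cubic `4x³ − Ax − B` with three distinct roots `a, b, c` is `4(x − a)(x − b)(x − c)`.
[folklore] -/
lemma cubic_eq_prod_of_roots {A B a b c : ℝ} (hab : a ≠ b) (hac : a ≠ c) (hbc : b ≠ c)
    (ha : 4 * a ^ 3 - A * a - B = 0) (hb : 4 * b ^ 3 - A * b - B = 0)
    (hc : 4 * c ^ 3 - A * c - B = 0) (x : ℝ) :
    4 * x ^ 3 - A * x - B = 4 * (x - a) * (x - b) * (x - c) := by
  have h1 : 4 * (a ^ 2 + a * b + b ^ 2) - A = 0 := by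
    have : (a - b) * (4 * (a ^ 2 + a * b + b ^ 2) - A) = 0 := by linear_combination ha - hb
    exact (mul_eq_zero.mp this).resolve_left (sub_ne_zero.mpr hab)
  have h2 : 4 * (a ^ 2 + a * c + c ^ 2) - A = 0 := by
    have : (a - c) * (4 * (a ^ 2 + a * c + c ^ 2) - A) = 0 := by linear_combination ha - hc
    exact (mul_eq_zero.mp this).resolve_left (sub_ne_zero.mpr hac)
  have h3 : a + b + c = 0 := by
    have : (b - c) * (4 * (a + b + c)) = 0 := by linear_combination h1 - h2
    have := (mul_eq_zero.mp this).resolve_left (sub_ne_zero.mpr hbc)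
    linarith
  obtain rfl : c = -a - b := by linarith
  obtain rfl : A = 4 * (a ^ 2 + a * b + b ^ 2) := by linarith
  obtain rfl : B = 4 * a ^ 3 - 4 * (a ^ 2 + a * b + b ^ 2) * a := by linarith
  ring

/-- For `a < b < c`: `{x < c | 4(x − a)(x − b)(x − c) > 0} = (a, b)`. [folklore] -/
lemma setOf_cubic_pos_lt_eq_Ioo {A B a b c : ℝ} (hab : a < b) (hbc : b < c)
    (h : ∀ x, 4 * x ^ 3 - A * x - B = 4 * (x - a) * (x - b) * (x - c)) :
    {x : ℝ | 0 < 4 * x ^ 3 - A * x - B ∧ x < c} = Ioo a b := by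
  ext x
  simp only [mem_setOf_eq, mem_Ioo, h]
  constructor
  · rintro ⟨hpos, hxc⟩
    have hprod : (x - a) * (x - b) < 0 := by
      by_contra hcon
      push Not at hcon
      have : 4 * (x - a) * (x - b) * (x - c) ≤ 0 := by
        rw [show 4 * (x - a) * (x - b) * (x - c) = (4 * ((x - a) * (x - b))) * (x - c) by ring]
        exact mul_nonpos_of_nonneg_of_nonpos (by positivity) (by linarith)
      linarith
    constructor
    · by_contra hxa
      push Not at hxa
      have : 0 ≤ (x - a) * (x - b) := mul_nonneg_of_nonpos_of_nonpos (by linarith) (by linarith)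
      linarith
    · by_contra hxb
      push Not at hxb
      have : 0 ≤ (x - a) * (x - b) := mul_nonneg (by linarith) (by linarith)
      linarith
  · rintro ⟨hax, hxb⟩
    refine ⟨?_, hxb.trans hbc⟩
    have h1 : 0 < x - a := by linarith
    have h2 : 0 < b - x := by linarith
    have h3 : 0 < c - x := by linarith
    rw [show 4 * (x - a) * (x - b) * (x - c) = 4 * (x - a) * (b - x) * (c - x) by ring]
    positivity

/-- A root `e` of `4x³ − Ax − B` at which the cubic does not change sign (positive on `(m, e)` and
on `(e, ∞)`) is a double root: `12e² = A`. [folklore] -/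
lemma twelve_mul_sq_sub_eq_zero {A B e m : ℝ} (he : 4 * e ^ 3 - A * e - B = 0) (hme : m < e)
    (hleft : ∀ x ∈ Ioo m e, 0 < 4 * x ^ 3 - A * x - B)
    (hright : ∀ x, e < x → 0 < 4 * x ^ 3 - A * x - B) : 12 * e ^ 2 - A = 0 := by
  set q : ℝ → ℝ := fun x ↦ 4 * x ^ 2 + 4 * e * x + (4 * e ^ 2 - A) with hq
  have hqc : Continuous q := by simp only [hq]; fun_prop
  have hqe : q e = 12 * e ^ 2 - A := by simp only [hq]; ring
  have hneg : ∀ x ∈ Ioo m e, q x < 0 := by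
    intro x hx
    have hf := hleft x hx
    rw [cubic_eq_mul_of_root he] at hf
    by_contra hcon
    push Not at hcon
    have : (x - e) * q x ≤ 0 := mul_nonpos_of_nonpos_of_nonneg (by linarith [hx.2]) hcon
    linarith
  have hpos : ∀ x, e < x → 0 < q x := by
    intro x hx
    have hf := hright x hx
    rw [cubic_eq_mul_of_root he] at hf
    by_contra hcon
    push Not at hcon
    have : (x - e) * q x ≤ 0 := mul_nonpos_of_nonneg_of_nonpos (by linarith) hcon
    linarith
  have h1 : q e ≤ 0 := by
    refine le_of_tendsto (hqc.continuousAt.tendsto.mono_left (nhdsWithin_le_nhds (s := Iio e))) ?_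
    filter_upwards [Ioo_mem_nhdsLT hme] with x hx using (hneg x hx).le
  have h2 : 0 ≤ q e := by
    refine ge_of_tendsto (hqc.continuousAt.tendsto.mono_left (nhdsWithin_le_nhds (s := Ioi e))) ?_
    filter_upwards [self_mem_nhdsWithin] with x hx using (hpos x hx).le
  linarith


/-! ### `℘` on a horizontal half-period line `w + ℝ` (`2w ∈ Λ`, `conj w = -w`) -/

section line

variable {w : ℂ}

/-- If `2w ∈ Λ` then `℘'(w) = 0` (`℘'` is odd and `Λ`-periodic; Whittaker–Watson §20.32).
[folklore] -/
lemma derivWeierstrassP_eq_zero_of_two_mul_mem (h2w : 2 * w ∈ L.lattice) : ℘'[L] w = 0 := by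
  have := L.derivWeierstrassP_sub_coe w ⟨2 * w, h2w⟩
  rw [Subtype.coe_mk, show w - 2 * w = -w by ring, derivWeierstrassP_neg] at this
  have h2 : (2 : ℂ) * ℘'[L] w = 0 := by linear_combination -this
  simpa using h2

/-- On a line `w + ℝ` with `2w ∈ Λ`, `conj w = -w`, `℘` of a real lattice is real
(`conj ℘(w + t) = ℘(-w + t) = ℘(w + t - 2w)`; Lawden §6.11). [folklore] -/
lemma IsReal.weierstrassP_line_im (h : L.IsReal) (h2w : 2 * w ∈ L.lattice) (hcw : conj w = -w)
    (t : ℝ) : (℘[L] (w + t)).im = 0 := by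
  rw [← Complex.conj_eq_iff_im, ← h.weierstrassP_conj, map_add, hcw, Complex.conj_ofReal]
  have := L.weierstrassP_sub_coe (w + t) ⟨2 * w, h2w⟩
  rwa [Subtype.coe_mk, show w + (t : ℂ) - 2 * w = -w + t by ring] at this

/-- On a line `w + ℝ` with `2w ∈ Λ`, `conj w = -w`, `℘'` of a real lattice is real. [folklore] -/
lemma IsReal.derivWeierstrassP_line_im (h : L.IsReal) (h2w : 2 * w ∈ L.lattice)
    (hcw : conj w = -w) (t : ℝ) : (℘'[L] (w + t)).im = 0 := by
  rw [← Complex.conj_eq_iff_im, ← h.derivWeierstrassP_conj, map_add, hcw, Complex.conj_ofReal]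
  have := L.derivWeierstrassP_sub_coe (w + t) ⟨2 * w, h2w⟩
  rwa [Subtype.coe_mk, show w + (t : ℂ) - 2 * w = -w + t by ring] at this

/-- `t ↦ re ℘(w + t)` has derivative `re ℘'(w + t)` off the lattice. [folklore] -/
lemma hasDerivAt_weierstrassP_line_re {t : ℝ} (hwt : w + t ∉ L.lattice) :
    HasDerivAt (fun s : ℝ ↦ (℘[L] (w + s)).re) (℘'[L] (w + t)).re t :=
  ((hasDerivAt_weierstrassP hwt).comp_const_add w t).real_of_complex

/-- `t ↦ re ℘'(w + t)` is differentiable off the lattice. [folklore] -/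
lemma hasDerivAt_derivWeierstrassP_line_re {t : ℝ} (hwt : w + t ∉ L.lattice) :
    HasDerivAt (fun s : ℝ ↦ (℘'[L] (w + s)).re) (deriv ℘'[L] (w + t)).re t := by
  have hd : DifferentiableAt ℂ ℘'[L] (w + t) :=
    L.differentiableOn_derivWeierstrassP.differentiableAt
      (L.isClosed_lattice.isOpen_compl.mem_nhds hwt)
  exact (hd.hasDerivAt.comp_const_add w t).real_of_complex

/-- The differential equation along the line: `(re ℘'(w + t))² = f(re ℘(w + t))`. [folklore] -/
lemma IsReal.derivWeierstrassP_line_re_sq (h : L.IsReal) (h2w : 2 * w ∈ L.lattice)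
    (hcw : conj w = -w) {t : ℝ} (hwt : w + t ∉ L.lattice) :
    (℘'[L] (w + t)).re ^ 2 =
      4 * (℘[L] (w + t)).re ^ 3 - L.g₂.re * (℘[L] (w + t)).re - L.g₃.re := by
  have hsq := L.derivWeierstrassP_sq (w + t) hwt
  have hP : (((℘[L] (w + t)).re : ℝ) : ℂ) = ℘[L] (w + t) :=
    Complex.ext (by simp) (by simp [h.weierstrassP_line_im h2w hcw t])
  have hP' : (((℘'[L] (w + t)).re : ℝ) : ℂ) = ℘'[L] (w + t) :=
    Complex.ext (by simp) (by simp [h.derivWeierstrassP_line_im h2w hcw t])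
  rw [← hP, ← hP', ← h.ofReal_g₂_re, ← h.ofReal_g₃_re] at hsq
  exact_mod_cast hsq

/-- `℘' ≠ 0` on the open segment `w + (0, Ω₀/2)`: a zero `z₀ ∉ Λ` of `℘'` has `2z₀ ∈ Λ`
(`two_mul_mem_lattice_of_derivWeierstrassP_eq_zero`), and `2(w + t) - 2w = 2t ∈ (0, Ω₀)` is
not a period. [folklore] -/
lemma IsReal.derivWeierstrassP_line_ne_zero (h : L.IsReal) (h2w : 2 * w ∈ L.lattice) {t : ℝ}
    (hwt : w + t ∉ L.lattice) (ht0 : 0 < t) (ht1 : t < L.minRealPeriod / 2) :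
    ℘'[L] (w + t) ≠ 0 := by
  intro h0
  have h2 := L.two_mul_mem_lattice_of_derivWeierstrassP_eq_zero hwt h0
  have : ((2 * t : ℝ) : ℂ) ∈ L.lattice := by
    have := sub_mem h2 h2w
    rwa [show 2 * (w + (t : ℂ)) - 2 * w = ((2 * t : ℝ) : ℂ) by push_cast; ring] at this
  exact h.ofReal_notMem_lattice (by positivity) (by linarith) this

/-- **The bounded segment** (Lawden §6.11–6.12, rectangular case): for a real lattice and a
horizontal line `w + ℝ` missing `Λ` with `2w ∈ Λ`, `conj w = -w`, the function `t ↦ ℘(w + t)`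
is real with non-vanishing derivative on `(0, Ω₀/2)`, so it maps `(0, Ω₀/2)` monotonically onto
an interval `(m, M)` whose endpoints `℘(w)`, `℘(w + Ω₀/2)` are roots of `f`, with `f > 0` on
`(m, M)` and, substituting `x = ℘(w + t)`, `∫_m^M dx/√f(x) = Ω₀/2`. [folklore] -/
theorem IsReal.exists_Ioo_integral_eq_of_line (h : L.IsReal) (h2w : 2 * w ∈ L.lattice)
    (hcw : conj w = -w) (hline : ∀ t : ℝ, w + t ∉ L.lattice) :
    ∃ m M : ℝ, m < M ∧ 4 * m ^ 3 - L.g₂.re * m - L.g₃.re = 0 ∧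
      4 * M ^ 3 - L.g₂.re * M - L.g₃.re = 0 ∧
      (∀ x ∈ Ioo m M, 0 < 4 * x ^ 3 - L.g₂.re * x - L.g₃.re) ∧
      ∫ x in Ioo m M, (Real.sqrt (4 * x ^ 3 - L.g₂.re * x - L.g₃.re))⁻¹ =
        L.minRealPeriod / 2 := by
  set T := L.minRealPeriod / 2 with hT
  have hT0 : 0 < T := by have := h.minRealPeriod_pos; positivity
  set φ : ℝ → ℝ := fun s ↦ (℘[L] (w + s)).re with hφ
  set ψ : ℝ → ℝ := fun s ↦ (℘'[L] (w + s)).re with hψ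
  set f : ℝ → ℝ := fun x ↦ 4 * x ^ 3 - L.g₂.re * x - L.g₃.re with hf
  have hder : ∀ s, HasDerivAt φ (ψ s) s := fun s ↦ hasDerivAt_weierstrassP_line_re (hline s)
  have hφc : Continuous φ := continuous_iff_continuousAt.mpr fun s ↦ (hder s).continuousAt
  have hψc : Continuous ψ := continuous_iff_continuousAt.mpr fun s ↦
    (hasDerivAt_derivWeierstrassP_line_re (hline s)).continuousAt
  have hsq : ∀ s, ψ s ^ 2 = f (φ s) := fun s ↦ h.derivWeierstrassP_line_re_sq h2w hcw (hline s)
  have hψne : ∀ s ∈ Ioo 0 T, ψ s ≠ 0 := by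
    intro s hs h0
    refine h.derivWeierstrassP_line_ne_zero h2w (hline s) hs.1 hs.2 ?_
    exact Complex.ext (by simpa [hψ] using h0) (by simp [h.derivWeierstrassP_line_im h2w hcw s])
  have hψ0 : ψ 0 = 0 := by
    simp only [hψ, Complex.ofReal_zero, add_zero]
    rw [derivWeierstrassP_eq_zero_of_two_mul_mem h2w, Complex.zero_re]
  have hψT : ψ T = 0 := by
    simp only [hψ]
    rw [derivWeierstrassP_eq_zero_of_two_mul_mem, Complex.zero_re]
    rw [show 2 * (w + ((T : ℝ) : ℂ)) = 2 * w + (L.minRealPeriod : ℂ) by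
      rw [hT]; push_cast; ring]
    exact add_mem h2w h.minRealPeriod_mem_lattice
  have hf0 : f (φ 0) = 0 := by rw [← hsq, hψ0]; ring
  have hfT : f (φ T) = 0 := by rw [← hsq, hψT]; ring
  have hfpos : ∀ s ∈ Ioo 0 T, 0 < f (φ s) := fun s hs ↦ by
    rw [← hsq, sq]; exact mul_self_pos.mpr (hψne s hs)
  -- `ψ` has constant sign on `(0, T)`
  have hsign : (∀ s ∈ Ioo 0 T, 0 < ψ s) ∨ (∀ s ∈ Ioo 0 T, ψ s < 0) := by
    by_contra hcon
    push Not at hcon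
    obtain ⟨⟨a, ha, hψa⟩, ⟨b, hb, hψb⟩⟩ := hcon
    have hψa' : ψ a < 0 := lt_of_le_of_ne hψa (hψne a ha)
    have hψb' : 0 < ψ b := lt_of_le_of_ne hψb (hψne b hb).symm
    have hsub : uIcc a b ⊆ Ioo 0 T := ordConnected_Ioo.uIcc_subset ha hb
    obtain ⟨c, hc, hψc0⟩ := intermediate_value_uIcc (hψc.continuousOn (s := uIcc a b))
      (mem_uIcc.mpr (Or.inl ⟨hψa'.le, hψb'.le⟩))
    exact hψne c (hsub hc) hψc0
  -- the change of variables `x = ℘(w + t)`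
  have hcv : ∀ _ : InjOn φ (Ioo 0 T), ∫ x in φ '' Ioo 0 T, (Real.sqrt (f x))⁻¹ = T := by
    intro hinj
    rw [integral_image_eq_integral_abs_deriv_smul measurableSet_Ioo
      (fun s _ ↦ (hder s).hasDerivWithinAt) hinj]
    have heq : EqOn (fun s ↦ |ψ s| • (Real.sqrt (f (φ s)))⁻¹) (fun _ ↦ (1 : ℝ)) (Ioo 0 T) := by
      intro s hs
      simp only [smul_eq_mul]
      rw [← hsq s, Real.sqrt_sq_eq_abs, mul_inv_cancel₀ (abs_ne_zero.mpr (hψne s hs))]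
    rw [setIntegral_congr_fun measurableSet_Ioo heq, setIntegral_const, smul_eq_mul, mul_one,
      Real.volume_real_Ioo_of_le hT0.le, sub_zero]
  rcases hsign with hpos | hneg
  · have hmono : StrictMonoOn φ (Icc 0 T) := by
      refine strictMonoOn_of_deriv_pos (convex_Icc 0 T) hφc.continuousOn fun s hs ↦ ?_
      rw [interior_Icc] at hs
      rw [(hder s).deriv]
      exact hpos s hs
    have himage : φ '' Ioo 0 T = Ioo (φ 0) (φ T) := by
      refine Subset.antisymm ?_ (intermediate_value_Ioo hT0.le hφc.continuousOn)
      rintro _ ⟨s, hs, rfl⟩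
      exact ⟨hmono (left_mem_Icc.mpr hT0.le) (Ioo_subset_Icc_self hs) hs.1,
        hmono (Ioo_subset_Icc_self hs) (right_mem_Icc.mpr hT0.le) hs.2⟩
    refine ⟨φ 0, φ T, hmono (left_mem_Icc.mpr hT0.le) (right_mem_Icc.mpr hT0.le) hT0, hf0, hfT,
      ?_, ?_⟩
    · intro x hx
      rw [← himage] at hx
      obtain ⟨s, hs, rfl⟩ := hx
      exact hfpos s hs
    · rw [← himage]
      exact hcv (hmono.injOn.mono Ioo_subset_Icc_self)
  · have hanti : StrictAntiOn φ (Icc 0 T) := by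
      refine strictAntiOn_of_deriv_neg (convex_Icc 0 T) hφc.continuousOn fun s hs ↦ ?_
      rw [interior_Icc] at hs
      rw [(hder s).deriv]
      exact hneg s hs
    have himage : φ '' Ioo 0 T = Ioo (φ T) (φ 0) := by
      refine Subset.antisymm ?_ (intermediate_value_Ioo' hT0.le hφc.continuousOn)
      rintro _ ⟨s, hs, rfl⟩
      exact ⟨hanti (Ioo_subset_Icc_self hs) (right_mem_Icc.mpr hT0.le) hs.2,
        hanti (left_mem_Icc.mpr hT0.le) (Ioo_subset_Icc_self hs) hs.1⟩
    refine ⟨φ T, φ 0, hanti (left_mem_Icc.mpr hT0.le) (right_mem_Icc.mpr hT0.le) hT0, hfT, hf0,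
      ?_, ?_⟩
    · intro x hx
      rw [← himage] at hx
      obtain ⟨s, hs, rfl⟩ := hx
      exact hfpos s hs
    · rw [← himage]
      exact hcv (hanti.injOn.mono Ioo_subset_Icc_self)

end line

/-! ### The bounded real component -/

/-- **The bounded real component** (Lawden (6.12.18) with §6.16): for a real lattice with
`g₂³ − 27g₃² > 0`, `∫_{{f > 0, x < e₁}} dx/√f(x) = Ω₀/2`.

Proof.  Let `Ω₀'` be the least positive real period of the real lattice `iΛ` and
`w = iΩ₀'/2` (`2w ∈ Λ`, `w ∉ Λ`, `conj w = -w`).  By the monotonicity theorem for `Λ` and for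
`iΛ`, `f > 0` on `(e₁, ∞)` and `f < 0` on `(-∞, ℘(w))`.  If `w + Ω₀/2 ∈ Λ` (rhombic lattice)
then `℘(w) = ℘(Ω₀/2) = e₁` is the only real root of `f`, contradicting `disc f > 0` (the
quadratic cofactor of `x - e₁` then has two real roots).  Otherwise (rectangular lattice) the
line `w + ℝ` misses `Λ` (`Λ ∩ ℝ = ℤΩ₀`) and `exists_Ioo_integral_eq_of_line` produces roots
`m < M ≤ e₁` with `f > 0` on `(m, M)` and `∫_m^M = Ω₀/2`; `M = e₁` would make `e₁` a double
root (`disc f = (g₂ − 3e₁²)(12e₁² − g₂)² ≠ 0`), so `m < M < e₁` are the three roots of `f` and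
`{f > 0, x < e₁} = (m, M)`. [folklore] -/
theorem IsReal.integral_inv_sqrt_cubic_of_discr_pos_eq (h : L.IsReal)
    (hdisc : 0 < L.g₂.re ^ 3 - 27 * L.g₃.re ^ 2) :
    ∫ x in {x : ℝ | 0 < 4 * x ^ 3 - L.g₂.re * x - L.g₃.re ∧
        x < L.weierstrassPRe (L.minRealPeriod / 2)},
        (Real.sqrt (4 * x ^ 3 - L.g₂.re * x - L.g₃.re))⁻¹ = L.minRealPeriod / 2 := by
  set e₁ := L.weierstrassPRe (L.minRealPeriod / 2) with he₁_def
  set A := L.g₂.re with hA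
  set B := L.g₃.re with hB
  have hΩ := h.minRealPeriod_pos
  have he₁ : 4 * e₁ ^ 3 - A * e₁ - B = 0 := h.cubic_weierstrassPRe_half
  have hright : ∀ x, e₁ < x → 0 < 4 * x ^ 3 - A * x - B := fun x hx ↦ h.cubic_pos_of_lt hx
  have h12 : 12 * e₁ ^ 2 - A ≠ 0 := by
    intro h0
    rw [cubic_discr_eq_of_root he₁, h0] at hdisc
    simp at hdisc
  -- the rotated lattice `iΛ` and the half-period `w = iΩ₀'/2`
  set L' := L.mulLeft I I_ne_zero with hL'
  have h' : L'.IsReal := h.mulLeft_I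
  have hΩ' := h'.minRealPeriod_pos
  set w : ℂ := I * ((L'.minRealPeriod / 2 : ℝ) : ℂ) with hw
  have h2w : 2 * w ∈ L.lattice := by
    have h1 : (L'.minRealPeriod : ℂ) ∈ L'.lattice := h'.minRealPeriod_mem_lattice
    rw [hL', mem_mulLeft_lattice, Complex.inv_I] at h1
    have := neg_mem h1
    convert this using 1
    rw [hw]; push_cast; ring
  have hcw : conj w = -w := by
    rw [hw, map_mul, Complex.conj_I, Complex.conj_ofReal]; ring
  have hw_notMem : w ∉ L.lattice := by
    intro hwmem
    have h1 : I * w ∈ L'.lattice := mul_mem_mulLeft_lattice.mpr hwmem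
    have h2 : ((L'.minRealPeriod / 2 : ℝ) : ℂ) ∈ L'.lattice := by
      have := neg_mem h1
      rw [hw, ← mul_assoc, Complex.I_mul_I] at this
      simpa using this
    have := h'.minRealPeriod_le ⟨by positivity, h2⟩
    linarith
  have hPw : (℘[L] w).re = -L'.weierstrassPRe (L'.minRealPeriod / 2) := by
    rw [hw, weierstrassP_I_mul, Complex.neg_re]
    rfl
  have hleft : ∀ x, x < (℘[L] w).re → 4 * x ^ 3 - A * x - B < 0 := by
    intro x hx
    rw [hPw] at hx
    exact h.cubic_neg_of_lt hx
  by_cases hcase : w + ((L.minRealPeriod / 2 : ℝ) : ℂ) ∈ L.lattice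
  · -- rhombic case: `℘(w) = ℘(-Ω₀/2) = e₁` is the only real root of `f`; impossible
    exfalso
    have hPw' : (℘[L] w).re = e₁ := by
      have := L.weierstrassP_sub_coe w ⟨_, hcase⟩
      rw [Subtype.coe_mk, show w - (w + ((L.minRealPeriod / 2 : ℝ) : ℂ)) =
        -((L.minRealPeriod / 2 : ℝ) : ℂ) by ring, weierstrassP_neg] at this
      rw [← this]
      rfl
    have honly : ∀ r, 4 * r ^ 3 - A * r - B = 0 → r = e₁ := by
      intro r hr
      rcases lt_trichotomy r e₁ with hlt | heq | hgt
      · have := hleft r (by rw [hPw']; exact hlt)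
        rw [hr] at this
        exact absurd this (lt_irrefl 0)
      · exact heq
      · have := hright r hgt
        rw [hr] at this
        exact absurd this (lt_irrefl 0)
    have hD : 0 < A - 3 * e₁ ^ 2 := by
      rw [cubic_discr_eq_of_root he₁] at hdisc
      exact pos_of_mul_pos_left hdisc (sq_nonneg _)
    set s := Real.sqrt (A - 3 * e₁ ^ 2) with hs
    have hs2 : s ^ 2 = A - 3 * e₁ ^ 2 := Real.sq_sqrt hD.le
    have hs0 : 0 < s := Real.sqrt_pos.mpr hD
    have hr₁ : 4 * ((-e₁ + s) / 2) ^ 3 - A * ((-e₁ + s) / 2) - B = 0 := by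
      rw [cubic_eq_mul_of_root he₁]
      have : 4 * ((-e₁ + s) / 2) ^ 2 + 4 * e₁ * ((-e₁ + s) / 2) + (4 * e₁ ^ 2 - A) = 0 := by
        linear_combination hs2
      rw [this, mul_zero]
    have hr₂ : 4 * ((-e₁ - s) / 2) ^ 3 - A * ((-e₁ - s) / 2) - B = 0 := by
      rw [cubic_eq_mul_of_root he₁]
      have : 4 * ((-e₁ - s) / 2) ^ 2 + 4 * e₁ * ((-e₁ - s) / 2) + (4 * e₁ ^ 2 - A) = 0 := by
        linear_combination hs2
      rw [this, mul_zero]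
    have h1 := honly _ hr₁
    have h2 := honly _ hr₂
    linarith
  · -- rectangular case: the line `w + ℝ` misses `Λ`
    have hline : ∀ t : ℝ, w + t ∉ L.lattice := by
      intro t ht
      have hct : -w + t ∈ L.lattice := by
        have := h _ ht
        rwa [map_add, hcw, Complex.conj_ofReal] at this
      have h2t : ((2 * t : ℝ) : ℂ) ∈ L.lattice := by
        convert add_mem ht hct using 1
        push_cast; ring
      obtain ⟨k, hk⟩ := h.exists_eq_int_mul h2t
      have hzmul : ∀ j : ℤ, ((j : ℝ) : ℂ) * (L.minRealPeriod : ℂ) ∈ L.lattice := by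
        intro j
        have := zsmul_mem h.minRealPeriod_mem_lattice j
        rw [zsmul_eq_mul] at this
        exact_mod_cast this
      rcases Int.even_or_odd k with ⟨j, rfl⟩ | ⟨j, rfl⟩
      · have ht' : t = j * L.minRealPeriod := by push_cast at hk; linarith
        have htmem : (t : ℂ) ∈ L.lattice := by
          rw [ht']; push_cast
          exact_mod_cast hzmul j
        exact hw_notMem (by simpa using sub_mem ht htmem)
      · have ht' : t = j * L.minRealPeriod + L.minRealPeriod / 2 := by push_cast at hk; linarith
        refine hcase ?_
        convert sub_mem ht (hzmul j) using 1
        rw [ht']; push_cast; ring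
    obtain ⟨m, M, hmM, hfm, hfM, hfpos, hint⟩ := h.exists_Ioo_integral_eq_of_line h2w hcw hline
    have hMe : M ≤ e₁ := by
      by_contra hcon
      push Not at hcon
      have := hright M hcon
      rw [hfM] at this
      exact lt_irrefl 0 this
    have hMne : M ≠ e₁ := by
      intro hMe₁
      apply h12
      refine twelve_mul_sq_sub_eq_zero he₁ (m := m) (by rw [← hMe₁]; exact hmM)
        (fun x hx ↦ hfpos x (by rw [hMe₁]; exact hx)) hright
    have hMlt : M < e₁ := lt_of_le_of_ne hMe hMne
    have hme : m ≠ e₁ := (hmM.trans hMlt).ne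
    have hprod := cubic_eq_prod_of_roots hmM.ne hme hMne hfm hfM he₁
    rw [setOf_cubic_pos_lt_eq_Ioo hmM hMlt hprod]
    exact hint

/-- Discharge of the named fact `IsReal.integral_inv_sqrt_cubic_of_discr_pos`
(Lawden (6.12.18), §6.16). [cite: Lawden1989, eq. (6.12.18) and §6.16] -/
theorem IsReal.integral_inv_sqrt_cubic_of_discr_pos_holds :
    IsReal.integral_inv_sqrt_cubic_of_discr_pos :=
  fun _ h hdisc ↦ h.integral_inv_sqrt_cubic_of_discr_pos_eq hdisc


/-! ### The real-period formula -/

/-- **Real-period formula** (Lawden (6.12.4), (6.12.18), (6.17.4), §6.16; Silverman AEC C.16):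
for a real lattice with `g₂³ − 27g₃² ≠ 0`, `2 ∫_{f > 0} dx/√f(x) = n · Ω₀` with `n = 2` if
`g₂³ − 27g₃² > 0` and `n = 1` otherwise.  Assembly: `{f > 0} = {f > 0, x < e₁} ∪ (e₁, ∞)`
(`f(e₁) = 0`, `f > 0` on `(e₁, ∞)`); the second piece contributes `Ω₀/2`
(`integral_Ioi_inv_sqrt_cubic_eq`), the first `Ω₀/2` if `disc f > 0`
(`integral_inv_sqrt_cubic_of_discr_pos_eq`) and nothing if `disc f < 0`, for then the quadratic
cofactor `(2x + e₁)² + 3e₁² − g₂` of `x − e₁` is positive and `f < 0` on `(-∞, e₁)`. [folklore] -/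
theorem IsReal.realPeriod_formula_eq (h : L.IsReal) (hdisc : L.g₂.re ^ 3 - 27 * L.g₃.re ^ 2 ≠ 0) :
    2 * ∫ x in {x : ℝ | 0 < 4 * x ^ 3 - L.g₂.re * x - L.g₃.re},
        (Real.sqrt (4 * x ^ 3 - L.g₂.re * x - L.g₃.re))⁻¹ =
      (if 0 < L.g₂.re ^ 3 - 27 * L.g₃.re ^ 2 then 2 else 1 : ℝ) * L.minRealPeriod := by
  set e₁ := L.weierstrassPRe (L.minRealPeriod / 2) with he₁_def
  set A := L.g₂.re with hA
  set B := L.g₃.re with hB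
  have hΩ := h.minRealPeriod_pos
  have he₁ : 4 * e₁ ^ 3 - A * e₁ - B = 0 := h.cubic_weierstrassPRe_half
  have hright : ∀ x, e₁ < x → 0 < 4 * x ^ 3 - A * x - B := fun x hx ↦ h.cubic_pos_of_lt hx
  have hI₁ : ∫ x in Ioi e₁, (Real.sqrt (4 * x ^ 3 - A * x - B))⁻¹ = L.minRealPeriod / 2 :=
    h.integral_Ioi_inv_sqrt_cubic_eq
  -- `{f > 0} = {f > 0, x < e₁} ∪ (e₁, ∞)`
  have hsplit : {x : ℝ | 0 < 4 * x ^ 3 - A * x - B} =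
      {x : ℝ | 0 < 4 * x ^ 3 - A * x - B ∧ x < e₁} ∪ Ioi e₁ := by
    ext x
    simp only [mem_setOf_eq, mem_union, mem_Ioi]
    constructor
    · intro hx
      rcases lt_trichotomy x e₁ with hlt | heq | hgt
      · exact Or.inl ⟨hx, hlt⟩
      · rw [heq, he₁] at hx
        exact absurd hx (lt_irrefl 0)
      · exact Or.inr hgt
    · rintro (⟨hx, _⟩ | hx)
      · exact hx
      · exact hright x hx
  by_cases hpos : 0 < A ^ 3 - 27 * B ^ 2
  · rw [if_pos hpos, hsplit]
    have hI₂ := h.integral_inv_sqrt_cubic_of_discr_pos_eq hpos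
    rw [setIntegral_union (disjoint_left.mpr fun x hx hx' ↦ hx.2.not_gt hx') measurableSet_Ioi
      ?_ ?_, hI₂, hI₁]
    · ring
    · by_contra hni
      rw [IntegrableOn] at hni
      rw [integral_undef hni] at hI₂
      linarith
    · by_contra hni
      rw [IntegrableOn] at hni
      rw [integral_undef hni] at hI₁
      linarith
  · rw [if_neg hpos]
    have hneg : A ^ 3 - 27 * B ^ 2 < 0 := lt_of_le_of_ne (not_lt.mp hpos) hdisc
    have hD : A - 3 * e₁ ^ 2 < 0 := by
      rw [cubic_discr_eq_of_root he₁] at hneg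
      by_contra hcon
      push Not at hcon
      have := mul_nonneg hcon (sq_nonneg (12 * e₁ ^ 2 - A))
      linarith
    have hempty : {x : ℝ | 0 < 4 * x ^ 3 - A * x - B ∧ x < e₁} = ∅ := by
      ext x
      simp only [mem_setOf_eq, mem_empty_iff_false, iff_false, not_and, not_lt]
      intro hx
      by_contra hcon
      push Not at hcon
      rw [cubic_eq_mul_of_root he₁] at hx
      have hq : 0 < 4 * x ^ 2 + 4 * e₁ * x + (4 * e₁ ^ 2 - A) := by
        nlinarith [sq_nonneg (2 * x + e₁)]
      have : (x - e₁) * (4 * x ^ 2 + 4 * e₁ * x + (4 * e₁ ^ 2 - A)) < 0 :=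
        mul_neg_of_neg_of_pos (by linarith) hq
      linarith
    rw [hsplit, hempty, empty_union, hI₁]
    ring

/-- Discharge of the named fact `IsReal.realPeriod_formula` (Lawden (6.12.4), (6.12.18),
(6.17.4), §6.16; Silverman AEC C.16).
[cite: Lawden1989, eqs. (6.12.4), (6.12.18), (6.17.4), §6.16; SilvermanAEC2009 C.16] -/
theorem IsReal.realPeriod_formula_holds : IsReal.realPeriod_formula :=
  fun _ h hdisc ↦ h.realPeriod_formula_eq hdisc

end PeriodPair

end
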